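import Literature.Barriers.CriticalPhenomena.PositionSpaceRGNonGibbsianSpacing
import HarnessLib

/-!
# Barrier `PositionSpaceRGNonGibbsian` (van Enter–Fernández–Sokal 1993, Theorem 4.2), layer 2:
# the estimate (4.32) from its finite-volume, uniform-in-the-boundary-condition form

Third companion file of `Literature/Barriers/CriticalPhenomena/PositionSpaceRGNonGibbsian.lean`,
on the line of Theorem 4.2 (`NonGibbs.VEFS1993_thm42`, `b = 2`, `d ≥ 3`, `β > β_c(d-1)`; the
barrier statement). `PositionSpaceRGNonGibbsianProofs.lean` reduced Theorem 4.2 to the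
Griffiths–Pearce–Israel estimate (4.32) (`NonGibbs.VEFS1993_eq432`);
`PositionSpaceRGNonGibbsianSpacing.lean` (the Theorem 4.3 line, spacing `b`) proved the general
transfer from uniform FINITE-VOLUME bounds on `⟨σ_0⟩^η_W` to a.e. bounds on
`E_{μT_b}(σ'_0 | {σ'_x}_{x≠0})` (`ae_le_condExpSpinAtOrigin_of_forall_isingExpect`, replacing the
printed Step 0 / Proposition 2.25 by the DLR equations in `W`). This file vendors the finite-volume
statement of the Theorem 4.2 line — §4.3.1 Steps 2–3 at the sharp threshold `J > J_{c,d-1}` — as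
the named fact `NonGibbs.VEFS1993_eq413` (same shape as the accepted `VEFS1993_eq413_spacing`,
with `(2, β_c(d-1))` in place of `(b, J₀(d,b))`), and proves
`VEFS1993_eq413 → VEFS1993_eq432 → VEFS1993_thm42`. Nothing is asserted (D-0014); the only
unproved declaration is `def VEFS1993_eq413 : Prop`.

## What the source prints (arXiv:hep-lat/9210032; section/equation numbers of the paper)

* §4.2 Step 2 (p. 105): "since we know only that the conditional distribution is some Gibbs
  measure for the internal-spin system, we need to prove the claimed bounds on `μ(f)` uniformly for
  all Gibbs measures for this system. To do this, it suffices to show that the bounds are satisfied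
  for a finite-volume internal-spin system, for some sufficiently large volume, uniformly in the
  (internal-spin) boundary conditions; that is, it suffices to show that there exists `R'' < ∞`
  such that the Gibbs measure for the internal-spin system in the volume `Λ^int_{R''}`, with image
  spins `ω' ∈ 𝒩_{R,R';+}` (or `𝒩_{R,R';-}`) and arbitrary internal-spin boundary condition …,
  satisfies the claimed bounds. For simplicity we shall take `R'' = R'`."; the claimed bounds
  (p. 105): "numbers `c₊, c₋` with `c₊ - c₋ ≥ δ` such that for every `ω' ∈ 𝒩₊` [resp.
  `ω' ∈ 𝒩₋`] … `μ(f) ≥ c₊` [resp. `μ(f) ≤ c₋`]".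
* §4.1.2 Step 3 (p. 99): "the system we really want to study is the system consisting of the
  internal spins in `Λ_{R+2}` and the spin at the origin, with the image spins in `Λ^image_R` other
  than the one at the origin fixed in the alternating configuration `ω'_alt`, the image spins in
  layer `Ω^image_{R+2}` set to be '+', and the spins outside `Λ_{R+2}` (both image and internal)
  fixed in some arbitrary configuration"; (4.13) (p. 100): "`⟨σ_{0,0}⟩^§_+ - ⟨σ_{0,0}⟩^§_- ≥ δ > 0`
  uniformly in `R` (sufficiently large) and in the configuration outside `Λ_{R+2}`."
* §4.3.1 (`d ≥ 3`, `b = 2`), Step 2, eqs. (4.26)–(4.27) (p. 109): "We want to show that, for `J`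
  sufficiently large, there exists `c > 0` such that for all `R > 0` there exists `R' > R`
  (depending on `R`) such that `⟨σ_i⟩^{R,R'}_{Σ,+,σ} ≥ ⟨σ_i⟩^{R,R'}_{Σ,+,-} ≥ c > 0` (4.26) and by
  symmetry `⟨σ_i⟩^{R,R'}_{Σ,-,σ} ≤ ⟨σ_i⟩^{R,R'}_{Σ,-,+} ≤ -c < 0` (4.27) for every configuration `σ`
  outside `Λ_{R'}` and every `i ∈ Λ^int_R`. This will be proven using correlation inequalities
  together with the uniqueness of the Gibbs measure for the internal-spin system with image spins
  set to all `+` or all `-`."; Step 3 (p. 112): "Finally, we can 'unfix' the spin at the origin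
  in the same way as in the 2-dimensional example."; Conclusion (p. 112): (4.32), "This works
  for any temperature below the critical temperature of the undiluted `(d-1)`-dimensional Ising
  model. We have therefore proven: Theorem 4.2 Let `d ≥ 2`. Then for all `J > J_{c,d-1}` …".

## What is formalised (namespace `Literature.Barriers.CriticalPhenomena.NonGibbs`)

* Named fact (not proved): `VEFS1993_eq413` — §4.3.1 Steps 2–3 for `b = 2`, `d ≥ 3`,
  `β > β_c(d-1)` in the finite-volume uniform form of §4.2 Step 2: `δ > 0`; for every `R` some
  `R' > R`, a finite volume `W ∋ 0` of original sites containing no other image site `2x`, and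
  levels `c₊ - c₋ ≥ δ`, with `⟨σ_0⟩^η_{W;β,0} ≥ c₊` for every boundary condition `η` with
  `T₂η ∈ 𝒩_{R,R',+}` and `≤ c₋` whenever `T₂η ∈ 𝒩_{R,R',-}`.
* Proved: `VEFS1993_eq432_of_eq413 : VEFS1993_eq413 → VEFS1993_eq432` (by the transfer lemmas of
  the spacing file at `b = 2`), `VEFS1993_thm42_of_eq413 : VEFS1993_eq413 → VEFS1993_thm42`,
  `positionSpaceRGNonGibbsian_of_eq413`, `dim_three_of_eq413`.

What remains for `VEFS1993_thm42_holds` is `VEFS1993_eq413`: Step 1 (spontaneous magnetisation of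
the periodically diluted internal-spin system for `J > J_{c,d-1}`, Griffiths' comparison with the
`(d-1)`-dimensional model), Steps 2.1–2.4 (weak limits; uniqueness for `+` image spins at all
temperatures; FKG comparison) and Step 3 (unfixing, (4.7)–(4.13)) of §4.3.1.
-/

noncomputable section

namespace Literature.Barriers.CriticalPhenomena.NonGibbs

open MeasureTheory ProbabilityTheory Filter Literature.Probability.LatticeModels
open scoped ENNReal

/-! ### The named fact: §4.3.1 Steps 2–3 in finite volume (`b = 2`, `d ≥ 3`, `J > J_{c,d-1}`) -/

/-- **van Enter–Fernández–Sokal 1993, §4.3.1 Steps 2–3 for `b = 2` decimation in dimension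
`d ≥ 3` — the uniform finite-volume estimate behind Theorem 4.2** (eqs. (4.26)–(4.27) combined
with the unfixing Step 3, i.e. §4.1.2 eqs. (4.7)–(4.13), in the finite-volume uniform form
prescribed in §4.2 Step 2: "it suffices to show that there exists `R'' < ∞` such that the Gibbs
measure for the internal-spin system in the volume `Λ^int_{R''}`, with image spins
`ω' ∈ 𝒩_{R,R';+}` (or `𝒩_{R,R';-}`) and arbitrary internal-spin boundary condition … satisfies the
claimed bounds. For simplicity we shall take `R'' = R'`"). For `d ≥ 3` and `β > β_c(d-1)` (the
tree's `criticalBeta (d-1)`; "This works for any temperature below the critical temperature of the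
undiluted `(d-1)`-dimensional Ising model"; `d = 2` is excluded as in `VEFS1993_thm42`) there is
`δ > 0` such that for every `R` there are `R' > R`, a finite set `W` of original sites containing
the origin and no other image site `2x` (`x ≠ 0`) — in the source, the internal spins of the cube
`Λ_{R'}` together with the spin at the origin — and levels `c₊`, `c₋` with `c₊ - c₋ ≥ δ`, such that
the finite-volume zero-field Ising expectation of the spin at the origin in `W` satisfies
`⟨σ_0⟩^η_{W;β,0} ≥ c₊` for EVERY boundary condition `η` whose decimation `T₂η` lies in
`𝒩_{R,R',+}` (image spins alternating on `Λ_R`, `+` on `Λ_{R'} ∖ Λ_R`, all other spins arbitrary)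
and `⟨σ_0⟩^η_{W;β,0} ≤ c₋` whenever `T₂η ∈ 𝒩_{R,R',-}` ((4.26): "there exists `c > 0` such that
for all `R > 0` there exists `R' > R` (depending on `R`) such that
`⟨σ_i⟩^{R,R'}_{Σ,+,σ} ≥ ⟨σ_i⟩^{R,R'}_{Σ,+,-} ≥ c > 0` … for every configuration `σ` outside
`Λ_{R'}`"; (4.13): "`⟨σ_{0,0}⟩^§_+ - ⟨σ_{0,0}⟩^§_- ≥ δ > 0` uniformly in `R` (sufficiently large)
and in the configuration outside"). Printed proof: Step 1 (the internal-spin system for `ω'_alt`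
is a periodically diluted zero-field ferromagnet, "more ferromagnetic than the
`(d-1)`-dimensional undiluted Ising model, and hence exhibits spontaneous magnetization for all
temperatures below the critical temperature `J_{c,d-1}`"), Steps 2.1–2.4 (weak limits are Gibbs
for `⟨R;∞;Σ;+⟩`; uniqueness of its Gibbs measure via the all-`+` image system, Lee–Yang /
Lebowitz–Penrose analyticity and Lebowitz' inequality (4.29); FKG domination of the `+` phase of
`⟨∞;Σ⟩`; its spontaneous magnetisation), Step 3 (unfixing). Same shape as
`VEFS1993_eq413_spacing` (Theorem 4.3 line) with `(2, β_c(d-1))` for `(b, J₀(d,b))`. Named fact,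
not proved here.
[cite: VanenterFernandezSokal1993, §4.3.1 Steps 2–3, eqs. (4.26)–(4.27); §4.1.2 eq. (4.13); §4.2 Step 2] -/
def VEFS1993_eq413 : Prop :=
  ∀ d : ℕ, 3 ≤ d → ∀ β : ℝ, criticalBeta (d - 1) < β → ∃ δ : ℝ, 0 < δ ∧
    ∀ R : ℕ, ∃ R' : ℕ, R < R' ∧ ∃ W : Finset (Site d), (0 : Site d) ∈ W ∧
      (∀ x : Site d, x ≠ 0 → (fun i => ((2 : ℕ) : ℤ) * x i) ∉ W) ∧
      ∃ cplus cminus : ℝ, δ ≤ cplus - cminus ∧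
        (∀ η : SpinConfig (Site d), decimate d 2 η ∈ plusSelected d R R' →
          cplus ≤ isingExpect (zdGraph d) W β 0 (.fixed η) (spinAt 0)) ∧
        (∀ η : SpinConfig (Site d), decimate d 2 η ∈ minusSelected d R R' →
          isingExpect (zdGraph d) W β 0 (.fixed η) (spinAt 0) ≤ cminus)

/-! ### Assembly: (4.32) and Theorem 4.2 from the finite-volume estimate -/

/-- **(4.32) from its finite-volume form (`b = 2`, `d ≥ 3`).** The uniform bounds of
`VEFS1993_eq413` on `⟨σ_0⟩^η_W` over boundary conditions `η` with `T₂η ∈ 𝒩_{R,R',±}` pass, by the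
DLR equations of `μ` in the volume `W` and the change of variables `ω = T₂η`
(`ae_le_condExpSpinAtOrigin_of_forall_isingExpect`, the printed Step 0 made rigorous), to the a.e.
bounds on `E_{μT}(σ'_0 | {σ'_x}_{x≠0})` constituting `VEFS1993_eq432`.
[cite: VanenterFernandezSokal1993, §4.1.2 Step 0, §4.2 Step 2, §4.3.1 eq. (4.32)] -/
theorem VEFS1993_eq432_of_eq413 (h413 : VEFS1993_eq413) : VEFS1993_eq432 := by
  intro d hd β hβ μ hμ
  obtain ⟨δ, hδ, hR⟩ := h413 d hd β hβ
  refine ⟨δ, hδ, fun R => ?_⟩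
  obtain ⟨R', hRR', W, h0, hW, cplus, cminus, hgap, hplus, hminus⟩ := hR R
  exact ⟨R', hRR', cplus, cminus, hgap,
    ae_le_condExpSpinAtOrigin_of_forall_isingExpect (b := 2) (by norm_num) hμ h0 hW hplus,
    ae_condExpSpinAtOrigin_le_of_forall_isingExpect (b := 2) (by norm_num) hμ h0 hW hminus⟩

/-- **Theorem 4.2 from the uniform finite-volume estimate**: §4.3.1 Steps 2–3 in finite volume
(`VEFS1993_eq413`, named fact) ⟹ (4.32) (`VEFS1993_eq432_of_eq413`, proved) ⟹ Theorem 4.2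
(`VEFS1993_thm42_of_eq432`, proved). What remains for `VEFS1993_thm42_holds` is exactly
`VEFS1993_eq413`. [cite: VanenterFernandezSokal1993, Theorem 4.2] -/
theorem VEFS1993_thm42_of_eq413 (h413 : VEFS1993_eq413) : VEFS1993_thm42 :=
  VEFS1993_thm42_of_eq432 (VEFS1993_eq432_of_eq413 h413)

/-- The barrier from the finite-volume estimate. [cite: VanenterFernandezSokal1993, Theorem 4.2] -/
theorem positionSpaceRGNonGibbsian_of_eq413 (h413 : VEFS1993_eq413) : PositionSpaceRGNonGibbsian :=
  positionSpaceRGNonGibbsian_of_eq432 (VEFS1993_eq432_of_eq413 h413)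

/-- Under the finite-volume estimate, at `d = 3`: for every `β > β_c(2) = ½ log(1+√2)` the `b = 2`
decimation step is not a map on Hamiltonians at `(β, 0)` for the nearest-neighbour Ising model on
`ℤ³`. [cite: VanenterFernandezSokal1993, Theorem 4.2 and Definition 3.1] -/
theorem dim_three_of_eq413 (h413 : VEFS1993_eq413) {β : ℝ} (hβ : criticalBeta 2 < β) :
    ¬ RenormalizedHamiltonianExists 3 (decimate 3 2) β 0 :=
  (positionSpaceRGNonGibbsian_of_eq413 h413).dim_three hβ

end Literature.Barriers.CriticalPhenomena.NonGibbs

end
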